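import Literature.NumberTheory.Transcendental.UnivExtTheta
import Literature.NumberTheory.Transcendental.UnivExtAlgPoints
import HarnessLib

/-!
# The theta model of `E♮`: kernel automorphy, non-degeneracy, algebraic points

Topic: `Literature/NumberTheory/Transcendental`. Sequel to `UnivExtTheta.lean` (theta functions
`Θ_I`, `I ∈ Fin 3 ⊕ Fin 3`, of the universal vectorial extension `E♮` on `Lie E♮_ℂ = ℂ²`), part
of the theta model (plan item W2 of the unit
`provefact-Literature.NumberTheory.Transcendental.H-b596640137`) for Baker's method on the groups
`M_κ` of `SemistableQuotients.lean`. PROVED here: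

* `PeriodPair.exists_univExtTheta_add_lattice` — **automorphy under the whole kernel**
  `Λ♮ = {(mω₁ + nω₂, mη₁ + nη₂)}` of `exp_{E♮}`: `Θ_I(v + λ) = c(v, λ) Θ_I(v)` for all `I`, with
  `c ≠ 0` independent of `I` (iteration of the generator case of `UnivExtTheta.lean`, both signs);
  so `[Θ] : E♮(ℂ) = ℂ²/Λ♮ → ℙ⁵(ℂ)` is well defined;
* `PeriodPair.exists_univExtTheta_lattice` — the values over the origin of `E`:
  `Θ(mω₁ + nω₂, t) = c · (0, 0, -2, 0, -1, -2(t - mη₁ - nη₂))`, i.e. the point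
  `t - η(λ) ∈ 𝔾ₐ = F₀ ⊂ E♮`, exactly the convention of `PeriodPair.IsUnivExtAlgPoint`
  (`AnalyticSubgroupElliptic.lean`) and of `GaGmE.Std.ker/Alg` (`SemistableQuotients.lean`);
* `PeriodPair.exists_univExtTheta_ne_zero` — **`Θ(v) ≠ 0` for every `v ∈ ℂ²`** (the linear
  system `|3F₀ + D_∞|` has no base points on `E♮`): off the lattice `Θ_{inl 0} = σ³ ≠ 0`, over
  the lattice `Θ_{inl 2} = -2c ≠ 0`;
* `PeriodPair.IsUnivExtAlgPoint.exists_isAlgebraic_univExtTheta_div` — **at `ℚ̄`-points of `E♮`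
  the projective point `[Θ(v)]` is `ℚ̄`-rational**: for `(z, t)` with
  `PeriodPair.IsUnivExtAlgPoint L z t` (and `g₂, g₃ ∈ ℚ̄`) all ratios `Θ_I(v)/Θ_{I₀}(v)` are
  algebraic for a suitable non-vanishing block `P_{i₀}(z) = Θ_{inl i₀}(v)` — off the lattice the ratios are
  `1, ℘, ℘′, ν, ℘ν, ℘′ν - 2℘²` (`℘′` algebraic by `y² = 4x³ - g₂x - g₃`), over the lattice they are
  `0, 0, 1, 0, 1/2, t - η(λ)`.

These are the facts about the coordinates `f_i = X_i ∘ φ ∘ exp_G` used in Baker's method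
(Baker–Wüstholz 2007, §6.8, pp. 116–119: `f_i(sv) = ϱ X_i(sγ)` with `ϱ ≠ 0` and `X_i(sγ)`
algebraic), for the factor `E♮` of `M_κ`.

## References

* A. Baker, G. Wüstholz, *Logarithmic Forms and Diophantine Geometry*, CUP 2007, §6.8.
* E. T. Whittaker, G. N. Watson, *A Course of Modern Analysis*, §§20.4–20.421.
-/

noncomputable section

open Complex
open scoped PeriodPair

namespace Literature.NumberTheory.Transcendental

variable (L : PeriodPair)

/-! ### Automorphy under the whole kernel `Λ♮` -/

/-- Automorphy under `ℤ · (ωⱼ, ηⱼ)`: for every integer `m` there is `c ≠ 0` (depending on `v`)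
with `Θ_I(z + mωⱼ, t + mηⱼ) = c Θ_I(z, t)` for all `I` (induction on `m`, both directions, from
the generator case `PeriodPair.univExtTheta_add_period`). [folklore] -/
theorem _root_.PeriodPair.exists_univExtTheta_add_int_mul (j : Fin 2) (m : ℤ) (z t : ℂ) :
    ∃ c : ℂ, c ≠ 0 ∧ ∀ I,
      L.univExtTheta I (z + m * L.basis j, t + m * L.quasiPeriod j) =
        c * L.univExtTheta I (z, t) := by
  induction m using Int.induction_on generalizing z t with
  | zero => exact ⟨1, one_ne_zero, fun I => by simp⟩
  | succ k ih =>
    obtain ⟨c, hc, h⟩ := ih z t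
    refine ⟨L.sigmaAut j (z + k * L.basis j) ^ 3 * c,
      mul_ne_zero (pow_ne_zero _ (L.sigmaAut_ne_zero j _)) hc, fun I => ?_⟩
    have e1 : z + ((k : ℤ) + 1 : ℤ) * L.basis j =
        (z + k * L.basis j) + L.basis j := by push_cast; ring
    have e2 : t + ((k : ℤ) + 1 : ℤ) * L.quasiPeriod j =
        (t + k * L.quasiPeriod j) + L.quasiPeriod j := by push_cast; ring
    rw [e1, e2, L.univExtTheta_add_period j I]
    have := h I
    push_cast at this
    rw [this]
    ring
  | pred k ih =>
    obtain ⟨c, hc, h⟩ := ih z t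
    set z' := z + (-(k : ℤ) - 1 : ℤ) * L.basis j with hz'
    set t' := t + (-(k : ℤ) - 1 : ℤ) * L.quasiPeriod j with ht'
    have e1 : z' + L.basis j = z + (-(k : ℤ) : ℤ) * L.basis j := by
      rw [hz']; push_cast; ring
    have e2 : t' + L.quasiPeriod j = t + (-(k : ℤ) : ℤ) * L.quasiPeriod j := by
      rw [ht']; push_cast; ring
    have hχ := L.sigmaAut_ne_zero j z'
    refine ⟨(L.sigmaAut j z' ^ 3)⁻¹ * c, mul_ne_zero (inv_ne_zero (pow_ne_zero _ hχ)) hc,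
      fun I => ?_⟩
    have key := L.univExtTheta_add_period j I z' t'
    rw [e1, e2, h I] at key
    -- `key : c Θ(z,t) = χ(z')³ Θ(z', t')`
    have hχ3 : L.sigmaAut j z' ^ 3 ≠ 0 := pow_ne_zero _ hχ
    calc L.univExtTheta I (z', t')
        = (L.sigmaAut j z' ^ 3)⁻¹ * (L.sigmaAut j z' ^ 3 * L.univExtTheta I (z', t')) := by
          rw [← mul_assoc, inv_mul_cancel₀ hχ3, one_mul]
      _ = (L.sigmaAut j z' ^ 3)⁻¹ * (c * L.univExtTheta I (z, t)) := by rw [key]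
      _ = (L.sigmaAut j z' ^ 3)⁻¹ * c * L.univExtTheta I (z, t) := by ring

/-- **Automorphy under the kernel `Λ♮` of `exp_{E♮}`**: for `λ = (mω₁ + nω₂, mη₁ + nη₂)` and
every `v = (z, t)` there is `c ≠ 0` with `Θ_I(v + λ) = c · Θ_I(v)` for ALL `I`; hence
`v ↦ [Θ(v)] ∈ ℙ⁵` is well defined on `E♮(ℂ) = ℂ²/Λ♮`. [folklore] -/
theorem _root_.PeriodPair.exists_univExtTheta_add_lattice (m n : ℤ) (z t : ℂ) :
    ∃ c : ℂ, c ≠ 0 ∧ ∀ I,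
      L.univExtTheta I (z + (m * L.ω₁ + n * L.ω₂), t + (m * L.η₁ + n * L.η₂)) =
        c * L.univExtTheta I (z, t) := by
  obtain ⟨c₁, hc₁, h₁⟩ := L.exists_univExtTheta_add_int_mul 0 m z t
  obtain ⟨c₂, hc₂, h₂⟩ := L.exists_univExtTheta_add_int_mul 1 n (z + m * L.ω₁) (t + m * L.η₁)
  refine ⟨c₂ * c₁, mul_ne_zero hc₂ hc₁, fun I => ?_⟩
  have e1 : z + (m * L.ω₁ + n * L.ω₂) = (z + m * L.ω₁) + n * L.ω₂ := by ring
  have e2 : t + (m * L.η₁ + n * L.η₂) = (t + m * L.η₁) + n * L.η₂ := by ring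
  simp only [PeriodPair.basis_zero, PeriodPair.basis_one, PeriodPair.quasiPeriod_zero,
    PeriodPair.quasiPeriod_one] at h₁ h₂
  rw [e1, e2, h₂ I, h₁ I, mul_assoc]

/-! ### Values over the origin of `E` -/

/-- **`Θ` over the origin of `E`**: for `λ = mω₁ + nω₂ ∈ Λ`,
`Θ(λ, t) = c · (0, 0, -2, 0, -1, -2(t - (mη₁ + nη₂)))` with `c ≠ 0` — the projective point of
`exp_{E♮}(λ, t) = t - η(λ) ∈ 𝔾ₐ ⊂ E♮` (convention of `PeriodPair.IsUnivExtAlgPoint`). [folklore] -/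
theorem _root_.PeriodPair.exists_univExtTheta_lattice (m n : ℤ) (t : ℂ) :
    ∃ c : ℂ, c ≠ 0 ∧
      L.univExtTheta (Sum.inl 0) (m * L.ω₁ + n * L.ω₂, t) = 0 ∧
      L.univExtTheta (Sum.inl 1) (m * L.ω₁ + n * L.ω₂, t) = 0 ∧
      L.univExtTheta (Sum.inl 2) (m * L.ω₁ + n * L.ω₂, t) = c * (-2) ∧
      L.univExtTheta (Sum.inr 0) (m * L.ω₁ + n * L.ω₂, t) = 0 ∧
      L.univExtTheta (Sum.inr 1) (m * L.ω₁ + n * L.ω₂, t) = c * (-1) ∧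
      L.univExtTheta (Sum.inr 2) (m * L.ω₁ + n * L.ω₂, t) =
        c * (-2 * (t - (m * L.η₁ + n * L.η₂))) := by
  obtain ⟨c, hc, h⟩ := L.exists_univExtTheta_add_lattice m n 0 (t - (m * L.η₁ + n * L.η₂))
  obtain ⟨v0, v1, v2, v3, v4, v5⟩ := L.univExtTheta_zero_left (t - (m * L.η₁ + n * L.η₂))
  have e : ∀ I, L.univExtTheta I (m * L.ω₁ + n * L.ω₂, t) =
      c * L.univExtTheta I (0, t - (m * L.η₁ + n * L.η₂)) := fun I => by
    have := h I
    simp only [zero_add, sub_add_cancel] at this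
    exact this
  refine ⟨c, hc, ?_, ?_, ?_, ?_, ?_, ?_⟩ <;> simp only [e, v0, v1, v2, v3, v4, v5, mul_zero]

/-! ### Non-degeneracy: `Θ` has no common zero -/

variable {L}

/-- **`Θ(v) ≠ 0` for every `v`**: off the lattice `Θ_{inl 0}(z, t) = σ(z)³ ≠ 0`, over the
lattice `Θ_{inl 2}(λ, t) = -2c ≠ 0` (the linear system `|3F₀ + D_∞|` is base-point free on `E♮`).
[folklore] -/
theorem _root_.PeriodPair.exists_univExtTheta_ne_zero (L : PeriodPair) (z t : ℂ) :
    ∃ I, L.univExtTheta I (z, t) ≠ 0 := by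
  by_cases hz : z ∈ L.lattice
  · obtain ⟨m, n, rfl⟩ := PeriodPair.mem_lattice.mp hz
    obtain ⟨c, hc, -, -, h2, -⟩ := L.exists_univExtTheta_lattice m n t
    exact ⟨Sum.inl 2, by rw [h2]; exact mul_ne_zero hc (by norm_num)⟩
  · refine ⟨Sum.inl 0, ?_⟩
    rw [(PeriodPair.univExtTheta_eq hz t).1]
    exact pow_ne_zero _ (L.weierstrassSigma_ne_zero hz)

/-! ### Algebraic points have `ℚ̄`-rational projective coordinates -/

/-- **At a `ℚ̄`-point of `E♮` the point `[Θ(v)] ∈ ℙ⁵` is `ℚ̄`-rational.** If `g₂, g₃ ∈ ℚ̄` and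
`(z, t)` exponentiates to an algebraic point of `E♮` (`PeriodPair.IsUnivExtAlgPoint`: either
`z = mω₁ + nω₂` and `t - (mη₁ + nη₂) ∈ ℚ̄`, or `z ∉ Λ` and `℘(z), t - ζ(z) ∈ ℚ̄`), then for a
suitable block `P_{i₀}` with `P_{i₀}(z) ≠ 0` (`= Θ_{inl i₀}(v)`) every ratio `Θ_I(v)/P_{i₀}(z)` is
algebraic: over the lattice `i₀ = 2` and the ratios are `0, 0, 1, 0, 1/2, t - η(λ)`; off the
lattice `i₀ = 0` and the ratios are `1, ℘, ℘′, ν, ℘ν, ℘′ν - 2℘²` (`℘′(z)` algebraic by the Weierstrass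
equation, `PeriodPair.isAlgebraic_derivWeierstrassP`). This is the input
"`f_i(sv) = ϱ X_i(sγ)` with `X_i(sγ) ∈ ℚ̄`" of Baker's method for the factor `E♮`
(Baker–Wüstholz 2007, §6.8, p. 119). [cite: BakerWustholz2007, §6.8 (p. 119)] -/
theorem _root_.PeriodPair.IsUnivExtAlgPoint.exists_isAlgebraic_univExtTheta_div {L : PeriodPair}
    (h₂ : IsAlgebraic ℚ L.g₂) (h₃ : IsAlgebraic ℚ L.g₃) {z t : ℂ} (h : L.IsUnivExtAlgPoint z t) :
    ∃ i₀ : Fin 3, L.univExtP i₀ z ≠ 0 ∧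
      ∀ I, IsAlgebraic ℚ (L.univExtTheta I (z, t) / L.univExtP i₀ z) := by
  rcases h with ⟨m, n, rfl, halg⟩ | ⟨hz, h℘, hν⟩
  · -- over the lattice: `z = mω₁ + nω₂`, ratios `0, 0, 1, 0, 1/2, t - η(λ)`
    obtain ⟨c, hc, v0, v1, v2, v3, v4, v5⟩ := L.exists_univExtTheta_lattice m n t
    simp only [PeriodPair.univExtTheta_inl] at v0 v1 v2
    have hP2 : L.univExtP 2 (m * L.ω₁ + n * L.ω₂) ≠ 0 := by
      rw [v2]; exact mul_ne_zero hc (by norm_num)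
    refine ⟨2, hP2, ?_⟩
    rintro (i | i) <;> fin_cases i
    · show IsAlgebraic ℚ (L.univExtTheta (Sum.inl 0) _ / _)
      rw [PeriodPair.univExtTheta_inl, v0, zero_div]; exact isAlgebraic_zero
    · show IsAlgebraic ℚ (L.univExtTheta (Sum.inl 1) _ / _)
      rw [PeriodPair.univExtTheta_inl, v1, zero_div]; exact isAlgebraic_zero
    · show IsAlgebraic ℚ (L.univExtTheta (Sum.inl 2) _ / _)
      rw [PeriodPair.univExtTheta_inl, div_self hP2]; exact isAlgebraic_one
    · show IsAlgebraic ℚ (L.univExtTheta (Sum.inr 0) _ / _)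
      rw [v3, zero_div]; exact isAlgebraic_zero
    · show IsAlgebraic ℚ (L.univExtTheta (Sum.inr 1) _ / _)
      rw [v4, v2, mul_div_mul_left _ _ hc,
        show ((-1 : ℂ) / -2) = ((2⁻¹ : ℚ) : ℂ) by push_cast; norm_num]
      exact isAlgebraic_algebraMap _
    · show IsAlgebraic ℚ (L.univExtTheta (Sum.inr 2) _ / _)
      rw [v5, v2, mul_div_mul_left _ _ hc, neg_mul, neg_div_neg_eq,
        mul_div_cancel_left₀ _ (two_ne_zero' ℂ)]
      exact halg
  · -- off the lattice: ratios `1, ℘, ℘′, ν, ℘ν, ℘′ν - 2℘²`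
    have h℘' : IsAlgebraic ℚ (℘'[L] z) := L.isAlgebraic_derivWeierstrassP hz h₂ h₃ h℘
    have hσ : L.weierstrassSigma z ^ 3 ≠ 0 := pow_ne_zero _ (L.weierstrassSigma_ne_zero hz)
    obtain ⟨v0, v1, v2, v3, v4, v5⟩ := PeriodPair.univExtTheta_eq hz t
    simp only [PeriodPair.univExtTheta_inl] at v0 v1 v2
    refine ⟨0, by rwa [v0], ?_⟩
    rintro (i | i) <;> fin_cases i
    · show IsAlgebraic ℚ (L.univExtTheta (Sum.inl 0) _ / _)
      rw [PeriodPair.univExtTheta_inl, div_self (by rwa [v0])]; exact isAlgebraic_one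
    · show IsAlgebraic ℚ (L.univExtTheta (Sum.inl 1) _ / _)
      rw [PeriodPair.univExtTheta_inl, v1, v0, mul_div_cancel_left₀ _ hσ]; exact h℘
    · show IsAlgebraic ℚ (L.univExtTheta (Sum.inl 2) _ / _)
      rw [PeriodPair.univExtTheta_inl, v2, v0, mul_div_cancel_left₀ _ hσ]; exact h℘'
    · show IsAlgebraic ℚ (L.univExtTheta (Sum.inr 0) _ / _)
      rw [v3, v0, mul_div_cancel_left₀ _ hσ]; exact hν
    · show IsAlgebraic ℚ (L.univExtTheta (Sum.inr 1) _ / _)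
      rw [v4, v0, mul_div_cancel_left₀ _ hσ]; exact h℘.mul hν
    · show IsAlgebraic ℚ (L.univExtTheta (Sum.inr 2) _ / _)
      rw [v5, v0, mul_div_cancel_left₀ _ hσ]
      exact (h℘'.mul hν).sub ((isAlgebraic_int 2).mul (h℘.pow 2))

end Literature.NumberTheory.Transcendental

end
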